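import Summits.ValiantsHypothesis.ValiantsHypothesis.Theorems.FifoMatchingNNDivisionHardLocatedRowsZeroDiag
import Summits.ValiantsHypothesis.ValiantsHypothesis.Theorems.FifoMatchingGridCorShadowOfCliqueFace
import HarnessLib

/-!
# LOCATED ROWS — part 3/8 — §4 ★★ the first non-trivial located case: the pair pencil DECIDES `Q∘` in Law currency (`pinnedRows_law_holds_on_qOff`, `entryTilted_law_holds_on_qOff`, `exactTilted_law_holds_on_qOff`)

Theorems-side port (staged by val-idea-40 g5 for the desk's P-W6b hand; declaration texts VERBATIM, namespace `…Theorems.FifoMatching.LocatedRows`) of val-idea-40 g5's crux workfile `Cruxes/NNDivisionHard/LocatedRows.lean` REV 5 @4b120a7727c3 (sha16 18e097fc3d9fe11e, 1953 l.; critic of record val-idea-crit-9 g2 VERDICTS #48 / #54 / #58: VERIFIED KEEP, axioms standard), split by the 400-line cap into seven chained modules `…RowFamilies` (§1, §2, §4e-frame) → `…LocatedRowsZeroDiag` (§3) → `…LocatedRowsPairPencil` (§4) → `…LocatedRowsPinExposed` (§4b) → `…LocatedRowsColumnCoupled` (§4c) → `…LocatedRowsPermutahedron` (§4c′, §4d)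 → `…LocatedRowsCeiling` (§5, §5b).

* `pairPencil_block`, `pencilRow`, `pinnedRows_law_holds_on_qOff`; `pairMat`, `flat_pairMat`, `entryTilted_law_holds_on_qOff`; rate `T_lt_of_block'`; `exactTilted_law_holds_on_qOff` (workfile §4e).

HONEST LABEL: helper rows for an OPEN crux (21181 `NNDivisionHard` OPEN; `ExactPencilLaw`, `allRows.Law`, COR-VIRTUAL OPEN); the `Law`s are `Prop`-valued definitions, nothing open is asserted; VP ≠ VNP is NOT proved.
-/

set_option autoImplicit false

-- the mandated summit-side namespace repeats a component by design (single-problem summit)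
set_option linter.dupNamespace false

noncomputable section

open Matrix Finset
open scoped Pointwise

namespace Summit.ValiantsHypothesis.ValiantsHypothesis.Theorems.FifoMatching.LocatedRows

open Literature.Barriers.PneNP (HasEFOfSize three_pow_le_card_mul_two_pow_of_cover_univ)
open Literature.Combinatorics.Optimization.FixedSizePsdRank (Cube bvec flat vecOuter corPolytope flat_dotProduct_vecOuter
  flat_dotProduct_le_of_mem_corPolytope)
open Summit.ValiantsHypothesis.ValiantsHypothesis.Theorems.FifoMatching.XcDivision
  (udInd udPt udRow udMat udInd_apply udInd_sq udInd_inter ud_data udRow_dotProduct_flat_diagonal flat_dotProduct_flat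
    dot_le_of_mem_convexHull)
open Summit.ValiantsHypothesis.Theorems.NNDivisionHardNegative.CliqueRowBlind (sum_udInd_mem sum_udInd_univ)
open Summit.ValiantsHypothesis.ValiantsHypothesis.Theorems.FifoMatching.GridCorShadow (four_T_lt_two_pow)
open Summit.ValiantsHypothesis.Theorems.NNDivisionHardNegative.DiagTilted
  (qOff qOffMat qOff_eq hasEFOfSize_qOff udRow_dotProduct_qOff udInd_compl udInd_univ)

/-! ## §4 ★★ The first non-trivial located case: the pair pencil decides `Q^∘` in Law currency -/

section Decide
variable {n : ℕ}

/-- ★★ **THE PAIR PENCIL BLOCK.**  For ANY right-hand-side function `mrow` dominating the pencil rows on `Q^∘` and attained, and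
ANY nonnegative factorization through `r + 1` slots of the augmented slack
`(1 + 2n² + mrow a) − ⟨udRow a + n²•pv, x_b + q_{e j}⟩` of `COR(n) + Q^∘`: `3^{n−2} ≤ (r+1)·2^{n−2}`.
(Block: rows `a ⊆ [n]∖{i,m}`, columns `({i,m} ∪ b', P*)`; there the slack is `(1 − |a ∩ b'|)²` by `val_le_val_star`.) -/
theorem pairPencil_block {i m : Fin n} (him : i ≠ m) {K r : ℕ} (e : Fin (K + 1) ≃ Finset (Fin n))
    (mrow : Finset (Fin n) → ℝ)
    (hle : ∀ a j, (udRow a + ((n : ℝ) ^ 2) • pv i m) ⬝ᵥ qOff (e j) ≤ mrow a)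
    (hat : ∀ a, ∃ j, (udRow a + ((n : ℝ) ^ 2) • pv i m) ⬝ᵥ qOff (e j) = mrow a)
    (U : Finset (Fin n) → Option (Fin r) → ℝ) (V : Finset (Fin n) × Fin (K + 1) → Option (Fin r) → ℝ)
    (hU : ∀ a s, 0 ≤ U a s) (hV : ∀ p s, 0 ≤ V p s)
    (hfac : ∀ a b j, ((1 + 2 * (n : ℝ) ^ 2) + mrow a) - (udRow a + ((n : ℝ) ^ 2) • pv i m) ⬝ᵥ (udPt b + qOff (e j))
      = ∑ s, U a s * V (b, j) s) :
    3 ^ (n - 2) ≤ (r + 1) * 2 ^ (n - 2) := by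
  classical
  -- the free ground set G = {i,m}ᶜ as a type
  let G : Finset (Fin n) := ({i, m} : Finset (Fin n))ᶜ
  let α := {x : Fin n // x ∈ G}
  have hcardα : Fintype.card α = n - 2 := by
    rw [Fintype.card_coe, Finset.card_compl, Finset.card_pair him, Fintype.card_fin]
  let emb : α ↪ Fin n := Function.Embedding.subtype _
  let row : Finset α → Finset (Fin n) := fun a' => a'.map emb
  let jstar : Fin (K + 1) := e.symm G
  let col : Finset α → Finset (Fin n) × Fin (K + 1) := fun b' => (({i, m} : Finset (Fin n)) ∪ b'.map emb, jstar)
  have hrowG : ∀ a' : Finset α, row a' ⊆ G := fun a' x hx => by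
    obtain ⟨y, -, rfl⟩ := Finset.mem_map.1 hx; exact y.2
  obtain ⟨-, -, slack, -⟩ := ud_data n
  have key := three_pow_le_of_block (ι := Option (Fin r)) U V hU hV row col ?_
  · rw [hcardα, Fintype.card_option, Fintype.card_fin] at key; exact key
  intro a' b'
  rw [← hfac (row a') _ jstar]
  -- m equals the value at P* on rows inside G
  have hm : mrow (row a') = val i m (row a') G := by
    obtain ⟨j₀, hj₀⟩ := hat (row a')
    have h1 : val i m (row a') (e j₀) = mrow (row a') := hj₀
    have h2 := hle (row a') jstar
    have h2' : val i m (row a') G ≤ mrow (row a') := by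
      have : e jstar = G := e.apply_symm_apply G
      rw [← this]; exact h2
    have h3 := val_le_val_star him (hrowG a') (e j₀)
    rw [h1] at h3
    exact le_antisymm h3 h2'
  have hGe : e jstar = G := e.apply_symm_apply G
  -- the three parts of the slack
  have hud : udRow (row a') ⬝ᵥ udPt (({i, m} : Finset (Fin n)) ∪ b'.map emb)
      = 1 - (1 - (((a' ∩ b').card : ℕ) : ℝ)) ^ 2 := by
    have := slack (row a') (({i, m} : Finset (Fin n)) ∪ b'.map emb)
    have hint : row a' ∩ (({i, m} : Finset (Fin n)) ∪ b'.map emb) = (a' ∩ b').map emb := by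
      rw [Finset.inter_union_distrib_left, Finset.map_inter]
      have h0 : row a' ∩ ({i, m} : Finset (Fin n)) = ∅ := by
        refine Finset.subset_empty.1 fun x hx => ?_
        have hxG := hrowG a' (Finset.mem_inter.1 hx).1
        exact absurd (Finset.mem_inter.1 hx).2 (Finset.mem_compl.1 hxG)
      rw [h0, Finset.empty_union]
    rw [hint, Finset.card_map] at this
    linarith
  have hpvb : pv i m ⬝ᵥ udPt (({i, m} : Finset (Fin n)) ∪ b'.map emb) = 2 := by
    rw [pv_dotProduct_udPt him, udInd_apply, udInd_apply, if_pos (by simp), if_pos (by simp)]; ring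
  show ((1 + 2 * (n : ℝ) ^ 2) + mrow (row a')) - (udRow (row a') + ((n : ℝ) ^ 2) • pv i m) ⬝ᵥ
      (udPt (({i, m} : Finset (Fin n)) ∪ b'.map emb) + qOff (e jstar)) = (1 - ((a' ∩ b').card : ℝ)) ^ 2
  rw [dotProduct_add, hGe, show (udRow (row a') + ((n : ℝ) ^ 2) • pv i m) ⬝ᵥ qOff G = val i m (row a') G from rfl,
    ← hm, add_dotProduct, smul_dotProduct, smul_eq_mul, hud, hpvb]
  ring

/-- the pencil row as a member of `pinnedRows`: direction `n²•pv`, located vertex `S = {i,m}`, rhs `1 + 2n²`. -/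
def pencilRow {i m : Fin n} (him : i ≠ m) (a : Finset (Fin n)) : pinnedRows.A n :=
  (a, ⟨(((n : ℝ) ^ 2) • pv i m, {i, m}), fun x hx => by
    show ((n : ℝ) ^ 2) • pv i m ⬝ᵥ x ≤ ((n : ℝ) ^ 2) • pv i m ⬝ᵥ udPt {i, m}
    rw [smul_dotProduct, smul_dotProduct, smul_eq_mul, smul_eq_mul, pv_dotProduct_udPt_pair him]
    exact mul_le_mul_of_nonneg_left (pv_le_two him x hx) (by positivity)⟩)

/-- ★★ **C⁺_loc SEES `Q^∘`** (the first non-trivial located case, Law currency): for every `n`, every `i ≠ m`, every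
enumeration `e` of the vertices of the zero-diagonal cube, and every `m, U, V` as in `pinnedRows.Law`:
`3^{n−2} ≤ (r+1)·2^{n−2}`. -/
theorem pinnedRows_decide_qOff {i m : Fin n} (him : i ≠ m) {K r : ℕ} (e : Fin (K + 1) ≃ Finset (Fin n))
    (mm : pinnedRows.A n → ℝ)
    (hle : ∀ a j, pinnedRows.ρ n a ⬝ᵥ qOff (e j) ≤ mm a) (hat : ∀ a, ∃ j, pinnedRows.ρ n a ⬝ᵥ qOff (e j) = mm a)
    (U : pinnedRows.A n → Option (Fin r) → ℝ) (V : Finset (Fin n) × Fin (K + 1) → Option (Fin r) → ℝ)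
    (hU : ∀ a s, 0 ≤ U a s) (hV : ∀ p s, 0 ≤ V p s)
    (hfac : ∀ a b j, (pinnedRows.β n a + mm a) - pinnedRows.ρ n a ⬝ᵥ (udPt b + qOff (e j)) = ∑ s, U a s * V (b, j) s) :
    3 ^ (n - 2) ≤ (r + 1) * 2 ^ (n - 2) := by
  refine pairPencil_block him e (fun a => mm (pencilRow him a)) (fun a j => hle (pencilRow him a) j)
    (fun a => hat (pencilRow him a)) (fun a => U (pencilRow him a)) V (fun a s => hU _ s) hV (fun a b j => ?_)
  have h := hfac (pencilRow him a) b j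
  have hβ : pinnedRows.β n (pencilRow him a) = 1 + 2 * (n : ℝ) ^ 2 := by
    show 1 + ((n : ℝ) ^ 2) • pv i m ⬝ᵥ udPt {i, m} = 1 + 2 * (n : ℝ) ^ 2
    rw [smul_dotProduct, smul_eq_mul, pv_dotProduct_udPt_pair him]; ring
  rw [hβ] at h
  exact h

/-- the same in the Law's literal quantifier shape: the `pinnedRows`-law RESTRICTED to the zero-diagonal cube holds at the
rate `1.5^{n−2}` — for every enumeration `q = qOff ∘ e` the law's three hypotheses force `3^{n−2} ≤ (r+1)·2^{n−2}`. -/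
theorem pinnedRows_lawOn_qOff (n : ℕ) (hn : 2 ≤ n) {K r : ℕ} (e : Fin (K + 1) ≃ Finset (Fin n))
    (mm : pinnedRows.A n → ℝ)
    (hle : ∀ a j, pinnedRows.ρ n a ⬝ᵥ (qOff ∘ e) j ≤ mm a) (hat : ∀ a, ∃ j, pinnedRows.ρ n a ⬝ᵥ (qOff ∘ e) j = mm a)
    (U : pinnedRows.A n → Option (Fin r) → ℝ) (V : Finset (Fin n) × Fin (K + 1) → Option (Fin r) → ℝ)
    (hU : ∀ a s, 0 ≤ U a s) (hV : ∀ p s, 0 ≤ V p s)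
    (hfac : ∀ a b j, (pinnedRows.β n a + mm a) - pinnedRows.ρ n a ⬝ᵥ (udPt b + (qOff ∘ e) j) = ∑ s, U a s * V (b, j) s) :
    3 ^ (n - 2) ≤ (r + 1) * 2 ^ (n - 2) := by
  have h01 : (⟨0, by omega⟩ : Fin n) ≠ ⟨1, by omega⟩ := by simp
  exact pinnedRows_decide_qOff h01 e mm hle hat U V hU hV hfac

/-! ### The pencil row inside C⁺ proper (`entryTilted`, box right-hand side = exact right-hand side here) -/

/-- the pair pencil as a MATRIX: `μ(E_im + E_mi)`. -/
def pairMat (i m : Fin n) (μ : ℝ) : Matrix (Fin n) (Fin n) ℝ := fun p q =>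
  if (p = i ∧ q = m) ∨ (p = m ∧ q = i) then μ else 0

/-- entries of `pairMat i m μ`. -/
theorem pairMat_eq {i m : Fin n} (him : i ≠ m) (μ : ℝ) (a b : Fin n) :
    pairMat i m μ a b = μ * (udInd {i, m} a * udInd {i, m} b - udInd {i} a * udInd {i} b - udInd {m} a * udInd {m} b) := by
  simp only [pairMat, udInd_apply, Finset.mem_insert, Finset.mem_singleton]
  by_cases hai : a = i
  · have ham : ¬ a = m := fun h => him (hai.symm.trans h)
    by_cases hbi : b = i
    · have hbm : ¬ b = m := fun h => him (hbi.symm.trans h)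
      simp [hai, hbi, him]
    · by_cases hbm : b = m
      · simp [hai, hbm, him, him.symm]
      · simp [hai, hbi, hbm, him]
  · by_cases ham : a = m
    · by_cases hbi : b = i
      · simp [ham, hbi, him, him.symm]
      · by_cases hbm : b = m
        · simp [ham, hbm, him.symm]
        · simp [ham, hbi, hbm, him.symm]
    · simp [hai, ham]

/-- `flat (μ(E_im + E_mi)) = μ • pv`. -/
theorem flat_pairMat {i m : Fin n} (him : i ≠ m) (μ : ℝ) : flat (pairMat i m μ) = μ • pv i m := by
  funext p
  simp only [flat, pv, udPt, vecOuter, Pi.smul_apply, Pi.sub_apply, smul_eq_mul]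
  exact pairMat_eq him μ _ _

/-- the box right-hand side of the pencil is its EXACT right-hand side: `Σ max(μ(E_im+E_mi)_pq, 0) = 2μ` (`μ ≥ 0`). -/
theorem box_pairMat {i m : Fin n} (him : i ≠ m) {μ : ℝ} (hμ : 0 ≤ μ) :
    ∑ p, ∑ q, max (pairMat i m μ p q) 0 = 2 * μ := by
  classical
  have h1 : ∀ p q, max (pairMat i m μ p q) 0 = pairMat i m μ p q * ((fun _ : Fin n => (1 : ℝ)) p * (fun _ => (1 : ℝ)) q) := by
    intro p q; simp only [mul_one]; unfold pairMat; split_ifs <;> simp [hμ]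
  simp_rw [h1]
  rw [← flat_dotProduct_vecOuter, flat_pairMat him]
  have hu : vecOuter n (fun _ : Fin n => (1 : ℝ)) = udPt (Finset.univ : Finset (Fin n)) := by
    show vecOuter n (fun _ => (1 : ℝ)) = vecOuter n (udInd Finset.univ)
    congr 1; funext j; rw [udInd_apply, if_pos (Finset.mem_univ j)]
  rw [hu, smul_dotProduct, smul_eq_mul, pv_dotProduct_udPt him, udInd_apply, udInd_apply, if_pos (Finset.mem_univ _),
    if_pos (Finset.mem_univ _)]
  ring

/-- ★★ **C⁺ (`entryTilted.Law` = `LocatedPencilLaw`) SEES `Q^∘`**: the rows `(a, n²(E_im + E_mi))` of `entryTilted` carry the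
box right-hand side `1 + 2n²`, which is exact, and their block decides the zero-diagonal cube: `3^{n−2} ≤ (r+1)·2^{n−2}`. -/
theorem entryTilted_decide_qOff {i m : Fin n} (him : i ≠ m) {K r : ℕ} (e : Fin (K + 1) ≃ Finset (Fin n))
    (mm : entryTilted.A n → ℝ)
    (hle : ∀ a j, entryTilted.ρ n a ⬝ᵥ qOff (e j) ≤ mm a) (hat : ∀ a, ∃ j, entryTilted.ρ n a ⬝ᵥ qOff (e j) = mm a)
    (U : entryTilted.A n → Option (Fin r) → ℝ) (V : Finset (Fin n) × Fin (K + 1) → Option (Fin r) → ℝ)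
    (hU : ∀ a s, 0 ≤ U a s) (hV : ∀ p s, 0 ≤ V p s)
    (hfac : ∀ a b j, (entryTilted.β n a + mm a) - entryTilted.ρ n a ⬝ᵥ (udPt b + qOff (e j)) = ∑ s, U a s * V (b, j) s) :
    3 ^ (n - 2) ≤ (r + 1) * 2 ^ (n - 2) := by
  let row : Finset (Fin n) → entryTilted.A n := fun a => (a, pairMat i m ((n : ℝ) ^ 2))
  have hρ : ∀ a, entryTilted.ρ n (row a) = udRow a + ((n : ℝ) ^ 2) • pv i m := fun a => by
    show udRow a + flat (pairMat i m ((n : ℝ) ^ 2)) = _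
    rw [flat_pairMat him]
  have hβ : ∀ a, entryTilted.β n (row a) = 1 + 2 * (n : ℝ) ^ 2 := fun a => by
    show 1 + ∑ p, ∑ q, max (pairMat i m ((n : ℝ) ^ 2) p q) 0 = _
    rw [box_pairMat him (by positivity)]
  refine pairPencil_block him e (fun a => mm (row a)) (fun a j => ?_) (fun a => ?_) (fun a => U (row a)) V
    (fun a s => hU _ s) hV (fun a b j => ?_)
  · rw [← hρ a]; exact hle (row a) j
  · obtain ⟨j, hj⟩ := hat (row a); exact ⟨j, by rw [← hρ a]; exact hj⟩
  · rw [← hρ a, ← hβ a]; exact hfac (row a) b j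

/-! ### Rate: the block count gives the Law's literal conclusion `T c n < r`, eventually in `n` -/

/-- arithmetic for the rate: `2^{⌊h/2⌋} · 2^h ≤ 3^h`. -/
theorem two_pow_half_mul_le (h : ℕ) : 2 ^ (h / 2) * 2 ^ h ≤ 3 ^ h := by
  have hh : h = 2 * (h / 2) + h % 2 := (Nat.div_add_mod h 2).symm
  have hv : h % 2 < 2 := Nat.mod_lt _ (by norm_num)
  generalize h / 2 = u at hh ⊢
  generalize h % 2 = v at hh hv ⊢
  subst hh
  calc 2 ^ u * 2 ^ (2 * u + v) = 2 ^ (3 * u) * 2 ^ v := by ring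
    _ = (2 ^ 3) ^ u * 2 ^ v := by rw [pow_mul]
    _ ≤ (3 ^ 2) ^ u * 3 ^ v :=
        Nat.mul_le_mul (Nat.pow_le_pow_left (by norm_num) u) (Nat.pow_le_pow_left (by norm_num) v)
    _ = 3 ^ (2 * u) * 3 ^ v := by rw [← pow_mul]
    _ = 3 ^ (2 * u + v) := by ring

/-- ★ RATE: `3^{n−2} ≤ (r+1)·2^{n−2} ⟹ T c n < r` for `n ≥ n₀(c)` (via the tree's `four_T_lt_two_pow`). -/
theorem T_lt_of_block (c : ℕ) : ∃ n₀ : ℕ, ∀ n ≥ n₀, ∀ r : ℕ, 3 ^ (n - 2) ≤ (r + 1) * 2 ^ (n - 2) → T c n < r := by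
  obtain ⟨t₁, ht₁⟩ := four_T_lt_two_pow c (c₀ := 1 / 4) (by norm_num)
  refine ⟨max t₁ 8, fun n hn r hr => ?_⟩
  have hn8 : 8 ≤ n := le_of_max_le_right hn
  have hdiv : n ≤ 4 * ((n - 2) / 2) := by omega
  have hreal : (1 / 4 : ℝ) * n ≤ (((n - 2) / 2 : ℕ) : ℝ) := by
    have : (n : ℝ) ≤ 4 * (((n - 2) / 2 : ℕ) : ℝ) := by exact_mod_cast hdiv
    linarith
  have h4 := ht₁ n (le_of_max_le_left hn) ((n - 2) / 2) hreal
  have hpow : 2 ^ ((n - 2) / 2) * 2 ^ (n - 2) ≤ (r + 1) * 2 ^ (n - 2) :=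
    (two_pow_half_mul_le (n - 2)).trans hr
  have hle : 2 ^ ((n - 2) / 2) ≤ r + 1 := Nat.le_of_mul_le_mul_right hpow (Nat.pos_of_ne_zero (by positivity))
  have hT : 1 ≤ T c n := Nat.one_le_two_pow
  unfold T at hT ⊢
  omega

/-- ★★★ **THE `pinnedRows`-LAW HOLDS ON THE ZERO-DIAGONAL CUBE** — `pinnedRows.Law` with its passenger quantifier specialised to
(every enumeration of) `Q^∘`, literal conclusion `T c n < r`: the first non-trivial located case, in the Law's own currency.
(The passenger that refutes C⁺_diag is decided by C⁺_loc; the `HasEFOfSize` budget hypothesis is not even used.) -/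
theorem pinnedRows_law_holds_on_qOff : ∀ c : ℕ, ∃ n₀ : ℕ, ∀ n ≥ n₀,
    ∀ (K : ℕ) (e : Fin (K + 1) ≃ Finset (Fin n)) (r : ℕ),
    HasEFOfSize (convexHull ℝ (Set.range (qOff ∘ e))) r →
    ∀ mm : pinnedRows.A n → ℝ, (∀ a j, pinnedRows.ρ n a ⬝ᵥ (qOff ∘ e) j ≤ mm a) →
      (∀ a, ∃ j, pinnedRows.ρ n a ⬝ᵥ (qOff ∘ e) j = mm a) →
    ∀ (U : pinnedRows.A n → Option (Fin r) → ℝ) (V : Finset (Fin n) × Fin (K + 1) → Option (Fin r) → ℝ),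
      (∀ a i, 0 ≤ U a i) → (∀ p i, 0 ≤ V p i) →
      (∀ a b j, (pinnedRows.β n a + mm a) - pinnedRows.ρ n a ⬝ᵥ (udPt b + (qOff ∘ e) j) = ∑ i, U a i * V (b, j) i) →
      T c n < r := by
  intro c
  obtain ⟨n₀, hn₀⟩ := T_lt_of_block c
  refine ⟨max n₀ 2, fun n hn K e r _ mm hle hat U V hU hV hfac => hn₀ n (le_of_max_le_left hn) r ?_⟩
  exact pinnedRows_lawOn_qOff n (le_of_max_le_right hn) e mm hle hat U V hU hV hfac

/-- ★★★ the same for C⁺ proper: **`entryTilted.Law` (= `LocatedPencilLaw`) HOLDS ON THE ZERO-DIAGONAL CUBE.** -/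
theorem entryTilted_law_holds_on_qOff : ∀ c : ℕ, ∃ n₀ : ℕ, ∀ n ≥ n₀,
    ∀ (K : ℕ) (e : Fin (K + 1) ≃ Finset (Fin n)) (r : ℕ),
    HasEFOfSize (convexHull ℝ (Set.range (qOff ∘ e))) r →
    ∀ mm : entryTilted.A n → ℝ, (∀ a j, entryTilted.ρ n a ⬝ᵥ (qOff ∘ e) j ≤ mm a) →
      (∀ a, ∃ j, entryTilted.ρ n a ⬝ᵥ (qOff ∘ e) j = mm a) →
    ∀ (U : entryTilted.A n → Option (Fin r) → ℝ) (V : Finset (Fin n) × Fin (K + 1) → Option (Fin r) → ℝ),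
      (∀ a i, 0 ≤ U a i) → (∀ p i, 0 ≤ V p i) →
      (∀ a b j, (entryTilted.β n a + mm a) - entryTilted.ρ n a ⬝ᵥ (udPt b + (qOff ∘ e) j) = ∑ i, U a i * V (b, j) i) →
      T c n < r := by
  intro c
  obtain ⟨n₀, hn₀⟩ := T_lt_of_block c
  refine ⟨max n₀ 2, fun n hn K e r _ mm hle hat U V hU hV hfac => hn₀ n (le_of_max_le_left hn) r ?_⟩
  have hn2 : 2 ≤ n := le_of_max_le_right hn
  have h01 : (⟨0, by omega⟩ : Fin n) ≠ ⟨1, by omega⟩ := by simp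
  exact entryTilted_decide_qOff h01 e mm hle hat U V hU hV hfac

end Decide

section ExactQOff
variable {n : ℕ}

/-- ★★★ **`ExactPencilLaw`'s body HOLDS ON THE ZERO-DIAGONAL CUBE `Q∘`** (the member that refuted C⁺_diag, ✓ p674104). -/
theorem exactTilted_law_holds_on_qOff : ∀ c : ℕ, ∃ n₀ : ℕ, ∀ n ≥ n₀,
    ∀ (K : ℕ) (e : Fin (K + 1) ≃ Finset (Fin n)) (r : ℕ),
    HasEFOfSize (convexHull ℝ (Set.range (qOff ∘ e))) r →
    ∀ mm : exactTilted.A n → ℝ, (∀ a j, exactTilted.ρ n a ⬝ᵥ (qOff ∘ e) j ≤ mm a) →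
      (∀ a, ∃ j, exactTilted.ρ n a ⬝ᵥ (qOff ∘ e) j = mm a) →
    ∀ (U : exactTilted.A n → Option (Fin r) → ℝ) (V : Finset (Fin n) × Fin (K + 1) → Option (Fin r) → ℝ),
      (∀ a i, 0 ≤ U a i) → (∀ p i, 0 ≤ V p i) →
      (∀ a b j, (exactTilted.β n a + mm a) - exactTilted.ρ n a ⬝ᵥ (udPt b + (qOff ∘ e) j) = ∑ i, U a i * V (b, j) i) →
      T c n < r := by
  intro c
  obtain ⟨n₀, hn₀⟩ := pinnedRows_law_holds_on_qOff c
  refine ⟨n₀, fun n hn K e r hq => ?_⟩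
  exact exact_body_of_pinned_body (qOff ∘ e) (hn₀ n hn K e r hq)

end ExactQOff

end Summit.ValiantsHypothesis.ValiantsHypothesis.Theorems.FifoMatching.LocatedRows
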